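import Literature.Computability.AlgebraicComplexity.LandsbergMichalekKoszul
import Literature.Computability.AlgebraicComplexity.AlderStrassenProofs
import Literature.Computability.AlgebraicComplexity.PartialMatrixMultiplicationProofs
import HarnessLib

/-!
# Landsberg–Michałek 2018, Thm. 1.1, Part 1: the border substitution method for `⟨n, w, n⟩`

Topic `Literature/Computability/AlgebraicComplexity`. Part 1 of the proof of Landsberg–Michałek 2018,
Thm. 1.1 (the named fact `LandsbergMichalek2018_thm_1_1` of `BorderRankMatMulSmall.lean`, discharged
in `BorderRankMatMulSmallProofs.lean`; Part 2 is `LandsbergMichalekKoszul.lean`). Everything is PROVED.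
LM18, §3, Part 1: "for any `k < n` there exists a Young diagram `λ` with `k` boxes such that
`R̲(M^λ) ≤ R̲(M) − k`", by the border substitution method (Prop. 2.3) and the normalisation Lemma 2.2
(closedness and `G`-invariance of the locus of good substitution directions). Here the limits of LM18
are replaced by algebra over `K[ε]` and by the Zariski-closedness of `{R̲ ≤ r}` (Alder's theorem,
PROVED in tree: `alder_secantVariety_eq_setOf_algBorderRank_le_holds`), which is why the main results
are over an algebraically closed field `K : Type` (applied to `ℂ`).

Conventions as in `LandsbergMichalekKoszul.lean`: `T = matMulTensor K n w n`, `T^λ = delSlices λ T`,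
Young diagrams = lower sets of `Fin n × Fin n` (product order, corner `(0,0)`).

## Content

* `IsApproxDecomposition.substitute` — **border substitution over `K[ε]`** (the algebraic content of
  LM18 Prop. 2.3 for one hyperplane): from `Σ_{ρ ≤ r} u_ρ ⊗ v_ρ ⊗ w_ρ = ε^h t + O(ε^{h+1})` with
  `u_{ρ₀} = ε^s ũ`, `x = ũ(0)`, the functionals `ℓ(ũ) e^a − ũ_a ℓ` (`ℓ = Σ g_a e^a`) kill `u_{ρ₀}` and
  give an order-`h` decomposition with `r` triads of `ℓ(x) t − x ⊗ ℓ(t)`. No limits are needed.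
* `exists_X_pow_mul_of_ne_zero`, `IsApproxDecomposition.proj_delSlices`, `exists_addable_le`,
  `exists_transvection_params` — bookkeeping (leading coefficients; dropping components on `λ`; the
  addable cell below a non-member of a Young diagram; parameters of the Borel move).
* `lmA`, `lmB`, `lmC`, `sum_lmA_lmB_lmC_delSlices`, `IsApproxDecomposition.lm_transform`,
  `sum_lmA_mul` — **the Borel symmetry**: for `P = 1 + λE_{α₁α₀}`, `Q = 1 + μE_{β₁β₀}` with
  `α₁ ≤ α₀`, `β₁ ≤ β₀` (a move towards the corner), `(π_λ(P⊗Q)) ⊗ (P^{-T}⊗1) ⊗ (1⊗Q^{-T})` fixes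
  `T^λ` (LM18: `GL(U) × GL(V)` stabilises `M`, the Borels stabilise `U_λ`), so it transports
  approximate decompositions of `T^λ`, moving the leading coefficient `x` to one that is non-zero at a
  prescribed addable cell `a₁ ≤ a₀`, `x(a₀) ≠ 0`.
* `algBorderRank_eval_zero_le` — **closedness of `{R̲ ≤ r}` along polynomial curves** (from Alder:
  a polynomial vanishing on `{R ≤ r}` composed with the curve has infinitely many roots);
  `algBorderRank_delSlices_insert_le` — **the torus degeneration** taking the substituted tensor
  `x(a₁) T^λ − x ⊗ T^λ(a₁,·,·)` to `x(a₁) T^{λ ∪ {a₁}}` (LM18: "by the torus action and Lemma 2.2 we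
  may assume that `a` has just one nonzero entry outside of `λ`").
* `exists_addable_algBorderRank_succ_le` (one step: `R̲(T^{λ∪{a₁}}) + 1 ≤ R̲(T^λ)` for an addable
  `a₁`) and `exists_isLowerSet_algBorderRank_add_le` — **LM18 Part 1**: for `m < n²`, `w ≥ 1` there
  is a Young diagram `λ` with `m` cells and `R̲(T^λ) + m ≤ R̲(T)`.

## References

* J. M. Landsberg, M. Michałek, *A `2n² − log₂(n) − 1` lower bound for the border rank of matrix
  multiplication*, IMRN 2018 (15) 4722–4733 = arXiv:1608.07486 (held: paper:arxiv-1608.07486,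
  chunks 4–5): Def. 2.1, Lemma 2.2, Prop. 2.3, §3 Part 1. [LandsbergMichalek2018]
* J. M. Landsberg, M. Michałek, arXiv:1601.08229, Lemma 5.2 and Cor. 5.3 (the border version of the
  Alexeev–Forbes–Tsimerman substitution method). [LandsbergMichalek2016Symmetry]
* P. Bürgisser, M. Clausen, M. A. Shokrollahi, *Algebraic Complexity Theory* (1997), Thm. (20.3)
  (Alder), in tree `AlderStrassenProofs.lean`. [BurgisserClausenShokrollahi1997]
-/

noncomputable section

open scoped BigOperators Polynomial
open Polynomial

namespace Literature.Computability.AlgebraicComplexity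

/-! ## Part 1a: the border substitution lemma -/

section Substitution

variable {K : Type*} [CommRing K] {ι κ μ : Type*} [Fintype ι]

/-- **Border substitution, algebraic form** (LM18 Prop. 2.3 / LM16 Lemma 5.2 for one hyperplane, made
explicit over `K[ε]`): let `∑_{ρ ≤ r} u_ρ ⊗ v_ρ ⊗ w_ρ = ε^h t + O(ε^{h+1})` and `u_{ρ₀} = ε^s ũ`. For
coefficients `g : ι → K` put `ℓ(f) = Σ_a g_a f_a`. The functionals `ℓ(ũ) e^a − ũ_a ℓ` kill `u_{ρ₀}`, and
applying them to the decomposition yields an approximate decomposition, of the same order and with the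
`r` remaining triads, of the substituted tensor
`t''(a,b,c) = ℓ(x) t(a,b,c) − x_a Σ_{a'} g_{a'} t(a',b,c)`, `x = ũ(0)`.
[cite: LandsbergMichalek2018, Prop. 2.3 (border substitution)] -/
theorem IsApproxDecomposition.substitute {h r : ℕ} {t : ι → κ → μ → K}
    {u : Fin (r + 1) → ι → K[X]} {v : Fin (r + 1) → κ → K[X]} {w : Fin (r + 1) → μ → K[X]}
    (hd : IsApproxDecomposition h t u v w) (ρ₀ : Fin (r + 1)) {s : ℕ} {ut : ι → K[X]}
    (hu : ∀ a, u ρ₀ a = X ^ s * ut a) (g : ι → K) :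
    IsApproxDecomposition h
      (fun a b c => (∑ a', g a' * (ut a').coeff 0) * t a b c - (ut a).coeff 0 * ∑ a', g a' * t a' b c)
      (fun ρ a => (∑ a', C (g a') * ut a') * u (ρ₀.succAbove ρ) a -
        ut a * ∑ a', C (g a') * u (ρ₀.succAbove ρ) a')
      (fun ρ => v (ρ₀.succAbove ρ)) (fun ρ => w (ρ₀.succAbove ρ)) := by
  rw [isApproxDecomposition_iff] at hd ⊢
  intro a b c
  choose Q hQ hQ0 using fun a => hd a b c
  refine ⟨(∑ a', C (g a') * ut a') * Q a - ut a * ∑ a', C (g a') * Q a', ?_, ?_⟩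
  · -- the sum over the remaining triads
    set P : ι → K[X] := fun a => ∑ ρ, u ρ a * v ρ b * w ρ c with hP
    set S : ι → K[X] := fun a => ∑ ρ : Fin r, u (ρ₀.succAbove ρ) a * v (ρ₀.succAbove ρ) b *
      w (ρ₀.succAbove ρ) c with hS
    set c₀ : K[X] := ∑ a', C (g a') * ut a' with hc₀
    have hsplit : ∀ a, S a = P a - u ρ₀ a * v ρ₀ b * w ρ₀ c := by
      intro a
      rw [hS, hP]
      simp only
      rw [Fin.sum_univ_succAbove _ ρ₀]
      ring
    have hPa : ∀ a, P a = X ^ h * Q a := fun a => by rw [hP]; exact hQ a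
    -- expand the new triads
    have e1 : ∑ ρ : Fin r, (c₀ * u (ρ₀.succAbove ρ) a - ut a * ∑ a', C (g a') * u (ρ₀.succAbove ρ) a') *
          v (ρ₀.succAbove ρ) b * w (ρ₀.succAbove ρ) c =
        c₀ * S a - ut a * ∑ a', C (g a') * S a' := by
      have e2 : ∑ a', C (g a') * S a' =
          ∑ ρ : Fin r, (∑ a', C (g a') * u (ρ₀.succAbove ρ) a') * v (ρ₀.succAbove ρ) b *
            w (ρ₀.succAbove ρ) c := by
        rw [hS]
        simp only [Finset.mul_sum, Finset.sum_mul]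
        rw [Finset.sum_comm]
        refine Finset.sum_congr rfl fun ρ _ => Finset.sum_congr rfl fun a' _ => by ring
      rw [e2, hS, Finset.mul_sum, Finset.mul_sum, ← Finset.sum_sub_distrib]
      refine Finset.sum_congr rfl fun ρ _ => by ring
    rw [e1, hsplit, Finset.sum_congr rfl fun a' _ => by rw [hsplit a'], hu a]
    simp_rw [hu, hPa]
    have e3 : ∑ a', C (g a') * (X ^ h * Q a' - X ^ s * ut a' * v ρ₀ b * w ρ₀ c) =
        X ^ h * ∑ a', C (g a') * Q a' - c₀ * (X ^ s * v ρ₀ b * w ρ₀ c) := by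
      rw [hc₀, Finset.mul_sum, Finset.sum_mul, ← Finset.sum_sub_distrib]
      refine Finset.sum_congr rfl fun a' _ => by ring
    rw [e3]
    ring
  · simp only [coeff_sub, mul_coeff_zero, finsetSum_coeff, coeff_C_zero, hQ0]

end Substitution

/-! ## Part 1b: leading coefficients, projection, the addable cell, choice of the transvection parameters -/

section Tools

variable {K : Type*} [Field K] {ι : Type*}

/-- A non-zero vector of polynomials is `ε^s` times a vector with non-zero constant term somewhere
(`s` = the least order of vanishing). [folklore] -/
theorem exists_X_pow_mul_of_ne_zero (f : ι → K[X]) (hf : f ≠ 0) :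
    ∃ (s : ℕ) (g : ι → K[X]), (∀ a, f a = X ^ s * g a) ∧ ∃ a, (g a).coeff 0 ≠ 0 := by
  classical
  have hex : ∃ j, ∃ a, (f a).coeff j ≠ 0 := by
    by_contra hall
    push Not at hall
    exact hf (funext fun a => Polynomial.ext fun j => by rw [hall j a]; rfl)
  set s := Nat.find hex with hs
  have hlow : ∀ a, ∀ i < s, (f a).coeff i = 0 := fun a i hi => by
    by_contra hc
    exact Nat.find_min hex hi ⟨a, hc⟩
  have hdvd : ∀ a, X ^ s ∣ f a := fun a => Polynomial.X_pow_dvd_iff.2 (hlow a)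
  choose g hg using hdvd
  obtain ⟨a₀, ha₀⟩ : ∃ a, (f a).coeff s ≠ 0 := Nat.find_spec hex
  refine ⟨s, g, hg, a₀, ?_⟩
  rw [hg a₀] at ha₀
  have := Polynomial.coeff_X_pow_mul (g a₀) s 0
  rw [Nat.zero_add] at this
  rwa [this] at ha₀

/-- If `t` has zero slices on `D`, the components on `D` of the first vectors of an approximate
decomposition may be dropped. [folklore] -/
theorem IsApproxDecomposition.proj_delSlices {κ μ : Type*} [DecidableEq ι] {h r : ℕ}
    (D : Finset ι) {t : ι → κ → μ → K} {u : Fin r → ι → K[X]} {v : Fin r → κ → K[X]}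
    {w : Fin r → μ → K[X]} (hd : IsApproxDecomposition h (delSlices D t) u v w) :
    IsApproxDecomposition h (delSlices D t) (fun ρ a => if a ∈ D then 0 else u ρ a) v w := by
  intro a b c j hj
  by_cases ha : a ∈ D
  · simp [ha, delSlices_apply]
  · simp only [ha, if_false]
    exact hd a b c j hj

/-- In a Young diagram (lower set) every non-member dominates an ADDABLE non-member: a cell `a₁ ≤ a₀`
outside `D` such that `D ∪ {a₁}` is again a lower set (LM18: "using the Borel action we can move the
entry south-west to obtain the desired Young diagram"). [cite: LandsbergMichalek2018, §3 (Part 1, second step)] -/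
theorem exists_addable_le {α : Type*} [PartialOrder α] [LocallyFiniteOrderBot α] [DecidableEq α]
    (D : Finset α) (hD : IsLowerSet (D : Set α)) {a₀ : α} (ha₀ : a₀ ∉ D) :
    ∃ a₁, a₁ ≤ a₀ ∧ a₁ ∉ D ∧ IsLowerSet ((insert a₁ D : Finset α) : Set α) := by
  obtain ⟨a₁, ha₁⟩ := Finset.exists_minimal (s := (Finset.Iic a₀).filter (· ∉ D))
    ⟨a₀, by simp [ha₀]⟩
  have h1 : a₁ ≤ a₀ ∧ a₁ ∉ D := by simpa [Finset.mem_filter, Finset.mem_Iic] using ha₁.1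
  refine ⟨a₁, h1.1, h1.2, ?_⟩
  intro b c hcb hb
  rw [Finset.mem_coe, Finset.mem_insert] at hb ⊢
  rcases hb with rfl | hb
  · by_cases hc : c = b
    · exact Or.inl hc
    · right
      by_contra hcD
      have hcmem : c ∈ (Finset.Iic a₀).filter (· ∉ D) := by simp [hcb.trans h1.1, hcD]
      exact hc (le_antisymm hcb (ha₁.2 hcmem hcb))
  · exact Or.inr (hD hcb hb)

/-- Choice of the transvection parameters: for `x(a₀) ≠ 0` and `a₁ ≤ a₀` there are `λ, μ ∈ {0, 1}`
(`λ = 0` if the first coordinates agree, `μ = 0` if the second do) with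
`x(α₁,β₁) + μ x(α₁,β₀) + λ x(α₀,β₁) + λμ x(α₀,β₀) ≠ 0`. [folklore] -/
theorem exists_transvection_params {n : ℕ} (x : Fin n × Fin n → K) (a₀ a₁ : Fin n × Fin n)
    (hx : x a₀ ≠ 0) :
    ∃ lam mu : K, (lam = 0 ∨ a₁.1 ≠ a₀.1) ∧ (mu = 0 ∨ a₁.2 ≠ a₀.2) ∧
      x (a₁.1, a₁.2) + mu * x (a₁.1, a₀.2) + lam * x (a₀.1, a₁.2) + lam * mu * x (a₀.1, a₀.2) ≠ 0 := by
  have hx' : x (a₀.1, a₀.2) ≠ 0 := hx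
  by_cases hβ : a₁.2 = a₀.2
  · -- `μ = 0`
    by_cases hα : a₁.1 = a₀.1
    · refine ⟨0, 0, Or.inl rfl, Or.inl rfl, ?_⟩
      rw [hα, hβ]; simpa using hx'
    · by_cases h1 : x (a₁.1, a₁.2) = 0
      · refine ⟨1, 0, Or.inr hα, Or.inl rfl, ?_⟩
        rw [hβ] at h1 ⊢
        simpa [h1] using hx'
      · exact ⟨0, 0, Or.inl rfl, Or.inl rfl, by simpa using h1⟩
  · by_cases hα : a₁.1 = a₀.1
    · -- `λ = 0`
      by_cases h1 : x (a₁.1, a₁.2) = 0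
      · refine ⟨0, 1, Or.inl rfl, Or.inr hβ, ?_⟩
        rw [hα] at h1 ⊢
        simpa [h1] using hx'
      · exact ⟨0, 0, Or.inl rfl, Or.inl rfl, by simpa using h1⟩
    · -- both free: first `μ` with `d = x(α₀,β₁) + μ x(a₀) ≠ 0`, then `λ`
      obtain ⟨mu, hmu⟩ : ∃ mu : K, x (a₀.1, a₁.2) + mu * x (a₀.1, a₀.2) ≠ 0 := by
        by_cases h2 : x (a₀.1, a₁.2) = 0
        · exact ⟨1, by simpa [h2] using hx'⟩
        · exact ⟨0, by simpa using h2⟩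
      by_cases h3 : x (a₁.1, a₁.2) + mu * x (a₁.1, a₀.2) = 0
      · refine ⟨1, mu, Or.inr hα, Or.inr hβ, ?_⟩
        have : x (a₁.1, a₁.2) + mu * x (a₁.1, a₀.2) + 1 * x (a₀.1, a₁.2) + 1 * mu * x (a₀.1, a₀.2) =
            (x (a₁.1, a₁.2) + mu * x (a₁.1, a₀.2)) + (x (a₀.1, a₁.2) + mu * x (a₀.1, a₀.2)) := by ring
        rw [this, h3, zero_add]
        exact hmu
      · refine ⟨0, mu, Or.inl rfl, Or.inr hβ, ?_⟩
        simpa using h3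

end Tools

/-! ## Part 1c: the Borel symmetry of `⟨n, w, n⟩^λ` -/

section Symmetry

variable {K : Type*} [Field K] {n w : ℕ}

/-- Entries of a transvection `1 + c E_{ij}`. [folklore] -/
theorem transvection_apply' (i j : Fin n) (c : K) (x y : Fin n) :
    Matrix.transvection i j c x y = (if x = y then 1 else 0) + (if i = x ∧ j = y then c else 0) := by
  simp [Matrix.transvection, Matrix.add_apply, Matrix.one_apply, Matrix.single_apply]

/-- `(1 + c E_{ij})(1 − c E_{ij}) = 1` when `i ≠ j` or `c = 0`. [folklore] -/
theorem transvection_mul_transvection_neg (i j : Fin n) (c : K) (h : c = 0 ∨ i ≠ j) :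
    Matrix.transvection i j c * Matrix.transvection i j (-c) = 1 := by
  rcases h with rfl | h
  · simp [Matrix.transvection_zero]
  · rw [Matrix.transvection_mul_transvection_same i j h, add_neg_cancel, Matrix.transvection_zero]

/-- `Σ_α P(x,α) P⁻(α,y) = δ(x,y)` for `P = 1 + c E_{ij}`, `P⁻ = 1 − c E_{ij}`. [folklore] -/
theorem sum_transvection_mul_transvection_neg (i j : Fin n) (c : K) (h : c = 0 ∨ i ≠ j) (x y : Fin n) :
    ∑ α, Matrix.transvection i j c x α * Matrix.transvection i j (-c) α y = if x = y then 1 else 0 := by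
  have := congrFun (congrFun (transvection_mul_transvection_neg i j c h) x) y
  rw [Matrix.mul_apply] at this
  rw [this, Matrix.one_apply]

/-- The first-factor map: `π_λ ∘ (P ⊗ Q)` with `P = 1 + λ E_{α₁α₀}`, `Q = 1 + μ E_{β₁β₀}` (the Borel move
`e_{α₀} ↦ e_{α₀} + λ e_{α₁}`, `e_{β₀} ↦ e_{β₀} + μ e_{β₁}`, followed by killing the deleted slices).
[cite: LandsbergMichalek2018, §3 (Part 1: "using the Borel action we can move the entry")] -/
def lmA (D : Finset (Fin n × Fin n)) (α₁ α₀ β₁ β₀ : Fin n) (lam mu : K) (a' a : Fin n × Fin n) : K :=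
  (if a' ∈ D then 0 else 1) * Matrix.transvection α₁ α₀ lam a'.1 a.1 *
    Matrix.transvection β₁ β₀ mu a'.2 a.2

/-- The second-factor map `P^{-T} ⊗ 1`. [cite: LandsbergMichalek2018, §3 (Part 1)] -/
def lmB (w : ℕ) (α₁ α₀ : Fin n) (lam : K) (b' b : Fin n × Fin w) : K :=
  Matrix.transvection α₁ α₀ (-lam) b.1 b'.1 * (if b'.2 = b.2 then 1 else 0)

/-- The third-factor map `1 ⊗ Q^{-T}`. [cite: LandsbergMichalek2018, §3 (Part 1)] -/
def lmC (w : ℕ) (β₁ β₀ : Fin n) (mu : K) (c' c : Fin w × Fin n) : K :=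
  (if c'.1 = c.1 then 1 else 0) * Matrix.transvection β₁ β₀ (-mu) c.2 c'.2

/-- The Borel move preserves `U_λ = span{e_a : a ∈ λ}` for a Young diagram `λ`: `(P ⊗ Q)(a', a) = 0`
for `a ∈ λ`, `a' ∉ λ` when `α₁ ≤ α₀`, `β₁ ≤ β₀` (LM18: "the product of Borel groups that stabilize the
flags induced by `λ'` stabilizes `M^{λ'}`"). [cite: LandsbergMichalek2018, §3 (Part 1, second step)] -/
theorem transvection_mul_eq_zero_of_mem (D : Finset (Fin n × Fin n))
    (hD : IsLowerSet (D : Set (Fin n × Fin n))) {α₁ α₀ β₁ β₀ : Fin n} (hα : α₁ ≤ α₀) (hβ : β₁ ≤ β₀)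
    (lam mu : K) {a a' : Fin n × Fin n} (ha : a ∈ D) (ha' : a' ∉ D) :
    Matrix.transvection α₁ α₀ lam a'.1 a.1 * Matrix.transvection β₁ β₀ mu a'.2 a.2 = 0 := by
  by_contra hne
  obtain ⟨h1, h2⟩ := mul_ne_zero_iff.1 hne
  rw [transvection_apply'] at h1 h2
  have h1' : a'.1 ≤ a.1 := by
    by_contra hlt
    apply h1
    rw [if_neg (fun h => hlt h.le), if_neg, add_zero]
    rintro ⟨rfl, rfl⟩
    exact hlt hα
  have h2' : a'.2 ≤ a.2 := by
    by_contra hlt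
    apply h2
    rw [if_neg (fun h => hlt h.le), if_neg, add_zero]
    rintro ⟨rfl, rfl⟩
    exact hlt hβ
  exact ha' (hD (show a' ≤ a from ⟨h1', h2'⟩) ha)

/-- **The Borel symmetry fixes `⟨n,w,n⟩^λ`**: `(π_λ(P ⊗ Q) ⊗ (P^{-T} ⊗ 1) ⊗ (1 ⊗ Q^{-T})) · T^λ = T^λ`
for `T = ⟨n, w, n⟩`, a Young diagram `λ` and a Borel move towards the corner
(`GL(U) × GL(V)` stabilises `M_{⟨n,n,w⟩}`; the Borels stabilise `U_λ`).
[cite: LandsbergMichalek2018, §3 (Part 1) and Lemma 2.2 (2)] -/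
theorem sum_lmA_lmB_lmC_delSlices (D : Finset (Fin n × Fin n))
    (hD : IsLowerSet (D : Set (Fin n × Fin n))) {α₁ α₀ β₁ β₀ : Fin n} (hα : α₁ ≤ α₀) (hβ : β₁ ≤ β₀)
    {lam mu : K} (hlam : lam = 0 ∨ α₁ ≠ α₀) (hmu : mu = 0 ∨ β₁ ≠ β₀)
    (a' : Fin n × Fin n) (b' : Fin n × Fin w) (c' : Fin w × Fin n) :
    ∑ a, ∑ b, ∑ c, lmA D α₁ α₀ β₁ β₀ lam mu a' a * lmB w α₁ α₀ lam b' b * lmC w β₁ β₀ mu c' c *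
        delSlices D (matMulTensor K n w n) a b c =
      delSlices D (matMulTensor K n w n) a' b' c' := by
  -- the inner sums over the second and third factor
  have inner : ∀ a, ∑ b, ∑ c, lmB w α₁ α₀ lam b' b * lmC w β₁ β₀ mu c' c *
      delSlices D (matMulTensor K n w n) a b c =
      if a ∈ D then 0 else Matrix.transvection α₁ α₀ (-lam) a.1 b'.1 *
        ((if c'.1 = b'.2 then 1 else 0) * Matrix.transvection β₁ β₀ (-mu) a.2 c'.2) := by
    intro a
    by_cases ha : a ∈ D
    · simp [delSlices_apply, ha]
    rw [if_neg ha]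
    simp only [delSlices_apply, ha, if_false]
    rw [Finset.sum_eq_single (a.1, b'.2)]
    · rw [Finset.sum_eq_single (b'.2, a.2)]
      · simp [lmB, lmC, matMulTensor]
      · intro c _ hc
        have : matMulTensor K n w n a (a.1, b'.2) c = 0 := by
          simp only [matMulTensor]
          rw [if_neg]
          rintro ⟨-, h2, h3⟩
          exact hc (Prod.ext h2.symm h3.symm)
        rw [this, mul_zero]
      · simp
    · intro b _ hb
      refine Finset.sum_eq_zero fun c _ => ?_
      by_cases h1 : a.1 = b.1
      · have h2 : b'.2 ≠ b.2 := fun h2 => hb (Prod.ext h1.symm h2.symm)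
        simp [lmB, h2]
      · have : matMulTensor K n w n a b c = 0 := by
          simp only [matMulTensor]
          rw [if_neg]
          exact fun h => h1 h.1
        rw [this, mul_zero]
    · simp
  -- factor the first-factor map out of the inner sums
  have e1 : ∀ a, ∑ b, ∑ c, lmA D α₁ α₀ β₁ β₀ lam mu a' a * lmB w α₁ α₀ lam b' b *
      lmC w β₁ β₀ mu c' c * delSlices D (matMulTensor K n w n) a b c =
      lmA D α₁ α₀ β₁ β₀ lam mu a' a * ∑ b, ∑ c, lmB w α₁ α₀ lam b' b * lmC w β₁ β₀ mu c' c *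
        delSlices D (matMulTensor K n w n) a b c := by
    intro a
    rw [Finset.mul_sum]
    refine Finset.sum_congr rfl fun b _ => ?_
    rw [Finset.mul_sum]
    exact Finset.sum_congr rfl fun c _ => by ring
  simp_rw [e1, inner]
  by_cases ha' : a' ∈ D
  · simp [lmA, ha', delSlices_apply]
  -- `a' ∉ D`: the deleted cells contribute nothing (Borel-stability of `U_λ`)
  have e2 : ∀ a, lmA D α₁ α₀ β₁ β₀ lam mu a' a *
      (if a ∈ D then 0 else Matrix.transvection α₁ α₀ (-lam) a.1 b'.1 *
        ((if c'.1 = b'.2 then 1 else 0) * Matrix.transvection β₁ β₀ (-mu) a.2 c'.2)) =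
      (if c'.1 = b'.2 then 1 else 0) *
        ((Matrix.transvection α₁ α₀ lam a'.1 a.1 * Matrix.transvection α₁ α₀ (-lam) a.1 b'.1) *
         (Matrix.transvection β₁ β₀ mu a'.2 a.2 * Matrix.transvection β₁ β₀ (-mu) a.2 c'.2)) := by
    intro a
    by_cases ha : a ∈ D
    · rw [if_pos ha, mul_zero]
      have := transvection_mul_eq_zero_of_mem D hD hα hβ lam mu ha ha'
      have e : Matrix.transvection α₁ α₀ lam a'.1 a.1 * Matrix.transvection α₁ α₀ (-lam) a.1 b'.1 *
          (Matrix.transvection β₁ β₀ mu a'.2 a.2 * Matrix.transvection β₁ β₀ (-mu) a.2 c'.2) =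
          (Matrix.transvection α₁ α₀ lam a'.1 a.1 * Matrix.transvection β₁ β₀ mu a'.2 a.2) *
          (Matrix.transvection α₁ α₀ (-lam) a.1 b'.1 * Matrix.transvection β₁ β₀ (-mu) a.2 c'.2) := by
        ring
      rw [e, this, zero_mul, mul_zero]
    · rw [if_neg ha, lmA, if_neg ha']
      ring
  simp_rw [e2]
  have e3 : ∑ a : Fin n × Fin n,
      Matrix.transvection α₁ α₀ lam a'.1 a.1 * Matrix.transvection α₁ α₀ (-lam) a.1 b'.1 *
        (Matrix.transvection β₁ β₀ mu a'.2 a.2 * Matrix.transvection β₁ β₀ (-mu) a.2 c'.2) =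
      (∑ α, Matrix.transvection α₁ α₀ lam a'.1 α * Matrix.transvection α₁ α₀ (-lam) α b'.1) *
        ∑ β, Matrix.transvection β₁ β₀ mu a'.2 β * Matrix.transvection β₁ β₀ (-mu) β c'.2 := by
    rw [Finset.sum_mul_sum, ← Finset.sum_product', Finset.univ_product_univ]
  rw [← Finset.mul_sum, e3, sum_transvection_mul_transvection_neg α₁ α₀ lam hlam,
    sum_transvection_mul_transvection_neg β₁ β₀ mu hmu, delSlices_apply, if_neg ha']
  simp only [matMulTensor]
  have h2' : (c'.1 = b'.2) ↔ (b'.2 = c'.1) := eq_comm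
  simp only [h2']
  by_cases h1 : a'.1 = b'.1 <;> by_cases h2 : b'.2 = c'.1 <;> by_cases h3 : a'.2 = c'.2 <;>
    simp [h1, h2, h3]

/-- **Transport of an approximate decomposition of `⟨n,w,n⟩^λ` along the Borel symmetry**: the
transformed vectors again form an approximate decomposition of `⟨n,w,n⟩^λ`, of the same order.
[cite: LandsbergMichalek2018, §3 (Part 1) and Lemma 2.2 (2)] -/
theorem IsApproxDecomposition.lm_transform (D : Finset (Fin n × Fin n))
    (hD : IsLowerSet (D : Set (Fin n × Fin n))) {α₁ α₀ β₁ β₀ : Fin n} (hα : α₁ ≤ α₀) (hβ : β₁ ≤ β₀)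
    {lam mu : K} (hlam : lam = 0 ∨ α₁ ≠ α₀) (hmu : mu = 0 ∨ β₁ ≠ β₀) {h r : ℕ}
    {u : Fin r → Fin n × Fin n → K[X]} {v : Fin r → Fin n × Fin w → K[X]}
    {w' : Fin r → Fin w × Fin n → K[X]}
    (hd : IsApproxDecomposition h (delSlices D (matMulTensor K n w n)) u v w') :
    IsApproxDecomposition h (delSlices D (matMulTensor K n w n))
      (fun ρ a' => ∑ a, C (lmA D α₁ α₀ β₁ β₀ lam mu a' a) * u ρ a)
      (fun ρ b' => ∑ b, C (lmB w α₁ α₀ lam b' b) * v ρ b)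
      (fun ρ c' => ∑ c, C (lmC w β₁ β₀ mu c' c) * w' ρ c) := by
  have key := hd.restrict (lmA D α₁ α₀ β₁ β₀ lam mu) (lmB w α₁ α₀ lam) (lmC w β₁ β₀ mu)
  have e : (fun a' b' c' => ∑ a, ∑ b, ∑ c, lmA D α₁ α₀ β₁ β₀ lam mu a' a * lmB w α₁ α₀ lam b' b *
      lmC w β₁ β₀ mu c' c * delSlices D (matMulTensor K n w n) a b c) =
      delSlices D (matMulTensor K n w n) :=
    funext fun a' => funext fun b' => funext fun c' =>
      sum_lmA_lmB_lmC_delSlices D hD hα hβ hlam hmu a' b' c'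
  rwa [e] at key

/-- The value at the target cell `a₁ = (α₁, β₁) ∉ λ` of the transformed vector:
`(π_λ(P ⊗ Q) x)(a₁) = x(α₁,β₁) + μ x(α₁,β₀) + λ x(α₀,β₁) + λμ x(α₀,β₀)`.
[cite: LandsbergMichalek2018, §3 (Part 1)] -/
theorem sum_lmA_mul (D : Finset (Fin n × Fin n)) (α₁ α₀ β₁ β₀ : Fin n) (lam mu : K)
    (ha₁ : (α₁, β₁) ∉ D) (x : Fin n × Fin n → K) :
    ∑ a, lmA D α₁ α₀ β₁ β₀ lam mu (α₁, β₁) a * x a =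
      x (α₁, β₁) + mu * x (α₁, β₀) + lam * x (α₀, β₁) + lam * mu * x (α₀, β₀) := by
  have hP : ∀ α, Matrix.transvection α₁ α₀ lam α₁ α =
      (if α = α₁ then 1 else 0) + (if α = α₀ then lam else 0) := by
    intro α; rw [transvection_apply']; simp [eq_comm]
  have hQ : ∀ β, Matrix.transvection β₁ β₀ mu β₁ β =
      (if β = β₁ then 1 else 0) + (if β = β₀ then mu else 0) := by
    intro β; rw [transvection_apply']; simp [eq_comm]
  have hin : ∀ (α : Fin n) (c : K), ∑ β, c * Matrix.transvection β₁ β₀ mu β₁ β * x (α, β) =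
      c * (x (α, β₁) + mu * x (α, β₀)) := by
    intro α c
    simp_rw [hQ]
    have s1 : ∑ β, (if β = β₁ then (1 : K) else 0) * x (α, β) = x (α, β₁) := by simp [ite_mul]
    have s2 : ∑ β, (if β = β₀ then mu else 0) * x (α, β) = mu * x (α, β₀) := by simp [ite_mul]
    rw [← s1, ← s2, mul_add, Finset.mul_sum, Finset.mul_sum, ← Finset.sum_add_distrib]
    exact Finset.sum_congr rfl fun β _ => by ring
  calc ∑ a, lmA D α₁ α₀ β₁ β₀ lam mu (α₁, β₁) a * x a
      = ∑ α, ∑ β, Matrix.transvection α₁ α₀ lam α₁ α * Matrix.transvection β₁ β₀ mu β₁ β * x (α, β) := by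
        rw [Fintype.sum_prod_type]
        refine Finset.sum_congr rfl fun α _ => Finset.sum_congr rfl fun β _ => ?_
        simp [lmA, ha₁]
    _ = ∑ α, Matrix.transvection α₁ α₀ lam α₁ α * (x (α, β₁) + mu * x (α, β₀)) :=
        Finset.sum_congr rfl fun α _ => hin α _
    _ = x (α₁, β₁) + mu * x (α₁, β₀) + lam * x (α₀, β₁) + lam * mu * x (α₀, β₀) := by
        simp_rw [hP]
        have s1 : ∑ α, (if α = α₁ then (1 : K) else 0) * (x (α, β₁) + mu * x (α, β₀)) =
            x (α₁, β₁) + mu * x (α₁, β₀) := by simp [ite_mul]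
        have s2 : ∑ α, (if α = α₀ then lam else 0) * (x (α, β₁) + mu * x (α, β₀)) =
            lam * (x (α₀, β₁) + mu * x (α₀, β₀)) := by simp [ite_mul]
        have : ∑ α, ((if α = α₁ then (1 : K) else 0) + (if α = α₀ then lam else 0)) *
            (x (α, β₁) + mu * x (α, β₀)) =
            (x (α₁, β₁) + mu * x (α₁, β₀)) + lam * (x (α₀, β₁) + mu * x (α₀, β₀)) := by
          rw [← s1, ← s2, ← Finset.sum_add_distrib]
          exact Finset.sum_congr rfl fun α _ => by ring
        rw [this]
        ring

end Symmetry

/-! ## Part 1d: degenerations along polynomial curves (closedness of `{R̲ ≤ r}`, via Alder) and the torus -/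

section Degeneration

/-- **`{t | R̲(t) ≤ r}` is closed under specialisation of polynomial curves**: if `t(τ)` is a polynomial
family of tensors over an algebraically closed field with `R̲(t(τ)) ≤ r` for all `τ ≠ 0`, then
`R̲(t(0)) ≤ r`. By Alder's theorem (BCS Thm. (20.3), in tree: `alder_secantVariety_eq_setOf_algBorderRank_le_holds`)
`{R̲ ≤ r}` is the Zariski closure of `{R ≤ r}`; a polynomial vanishing there vanishes at `t(τ)`, `τ ≠ 0`,
so the univariate polynomial `τ ↦ P(t(τ))` has infinitely many roots and vanishes at `0` too. This
replaces the limit arguments of LM18 Lemma 2.2 (1) ("Zariski closed").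
[cite: LandsbergMichalek2018, Lemma 2.2 (1)] -/
theorem algBorderRank_eval_zero_le {K : Type} [Field K] [IsAlgClosed K] {ι κ μ : Type} [Fintype ι]
    [Fintype κ] [Fintype μ] (f : ι → κ → μ → K[X]) (r : ℕ)
    (hf : ∀ τ : K, τ ≠ 0 → algBorderRank (fun a b c => (f a b c).eval τ) ≤ r) :
    algBorderRank (fun a b c => (f a b c).eval 0) ≤ r := by
  classical
  have hZ := alder_secantVariety_eq_setOf_algBorderRank_le_holds (K := K) (ι := ι) (κ := κ) (μ := μ) r
  have hmem : (fun a b c => (f a b c).eval 0) ∈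
      tensorZariskiClosure {s : ι → κ → μ → K | tensorRank s ≤ r} := by
    rw [mem_tensorZariskiClosure_iff]
    intro P hP
    set Φ : K[X] := MvPolynomial.aeval (fun x : ι × κ × μ => f x.1 x.2.1 x.2.2) P with hΦ
    have hΦeval : ∀ τ : K, Φ.eval τ =
        MvPolynomial.eval (uncurryTensor fun a b c => (f a b c).eval τ) P := by
      intro τ
      rw [hΦ, ← Polynomial.coe_aeval_eq_eval, ← AlgHom.comp_apply, MvPolynomial.comp_aeval,
        ← MvPolynomial.coe_aeval_eq_eval]
      rfl
    have hroots : ∀ τ : K, τ ≠ 0 → Φ.IsRoot τ := by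
      intro τ hτ
      rw [Polynomial.IsRoot, hΦeval]
      have hτZ : (fun a b c => (f a b c).eval τ) ∈
          tensorZariskiClosure {s : ι → κ → μ → K | tensorRank s ≤ r} := by
        rw [hZ]; exact hf τ hτ
      exact (mem_tensorZariskiClosure_iff _ _).1 hτZ P hP
    have hΦ0 : Φ = 0 := by
      apply Polynomial.eq_zero_of_infinite_isRoot
      refine Set.Infinite.mono (fun τ (hτ : τ ∈ {τ : K | τ ≠ 0}) => hroots τ hτ) ?_
      have : ({τ : K | τ ≠ 0}) = Set.univ \ {0} := by ext; simp
      rw [this]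
      exact Set.infinite_univ.sdiff (Set.finite_singleton 0)
    have := hΦeval 0
    rw [hΦ0, Polynomial.eval_zero] at this
    exact this.symm
  rw [hZ] at hmem
  exact hmem

variable {K : Type} [Field K] [IsAlgClosed K] {n w : ℕ}

/-- **The torus degeneration** (LM18 §3, Part 1: "By the torus action and Lemma 2.2 we may assume that
`a` has just one nonzero entry outside of `λ`"): if the substituted tensor
`t'' = x(a₁) T^λ − x ⊗ T^λ(a₁, ·, ·)` has `R̲ ≤ r` then so has `T^{λ ∪ {a₁}}`. The one-parameter torus
with weight `0` on the row and column index of `a₁` and `1` elsewhere rescales `t''` to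
`τ² (x(a₁) T^{λ∪{a₁}} + τ G(τ))`; conclude by `algBorderRank_eval_zero_le`.
[cite: LandsbergMichalek2018, §3 (Part 1) and Lemma 2.2] -/
theorem algBorderRank_delSlices_insert_le (D : Finset (Fin n × Fin n)) (a₁ : Fin n × Fin n)
    (x : Fin n × Fin n → K) (hx : x a₁ ≠ 0) (r : ℕ)
    (ht : algBorderRank (fun a b c => x a₁ * delSlices D (matMulTensor K n w n) a b c -
      x a * delSlices D (matMulTensor K n w n) a₁ b c) ≤ r) :
    algBorderRank (delSlices (insert a₁ D) (matMulTensor K n w n)) ≤ r := by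
  classical
  set T := matMulTensor K n w n with hT
  set t'' : (Fin n × Fin n) → (Fin n × Fin w) → (Fin w × Fin n) → K :=
    fun a b c => x a₁ * delSlices D T a b c - x a * delSlices D T a₁ b c with ht''
  -- torus weights
  set wt : Fin n × Fin n → ℕ := fun a => (if a.1 = a₁.1 then 0 else 1) + (if a.2 = a₁.2 then 0 else 1)
    with hwt
  set pB : Fin n × Fin w → ℕ := fun b => if b.1 = a₁.1 then 1 else 0 with hpB
  set pC : Fin w × Fin n → ℕ := fun c => if c.2 = a₁.2 then 1 else 0 with hpC
  -- the polynomial family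
  set f : (Fin n × Fin n) → (Fin n × Fin w) → (Fin w × Fin n) → K[X] :=
    fun a b c => if a.1 = b.1 ∧ a.2 = c.2 then C (t'' a b c) else X ^ wt a * C (t'' a b c) with hf
  -- weights on the support of `t''`
  have hsupp : ∀ a b c, t'' a b c ≠ 0 → ¬ (a.1 = b.1 ∧ a.2 = c.2) → pB b = 1 ∧ pC c = 1 := by
    intro a b c hne hnd
    have h1 : delSlices D T a b c = 0 := by
      rw [delSlices_apply]
      split_ifs
      · rfl
      · simp only [hT, matMulTensor]
        rw [if_neg]
        exact fun h => hnd ⟨h.1, h.2.2⟩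
    have h2 : delSlices D T a₁ b c ≠ 0 := by
      intro h2
      apply hne
      rw [ht'']
      simp only [h1, h2, mul_zero, sub_zero]
    rw [delSlices_apply] at h2
    split_ifs at h2 with h3
    · exact absurd rfl h2
    · simp only [hT, matMulTensor] at h2
      split_ifs at h2 with h4
      · rw [hpB, hpC]
        simp only
        rw [if_pos h4.1.symm, if_pos h4.2.2.symm]
        exact ⟨rfl, rfl⟩
      · exact absurd rfl h2
  have hdiag : ∀ (a : Fin n × Fin n) (b : Fin n × Fin w) (c : Fin w × Fin n),
      a.1 = b.1 ∧ a.2 = c.2 → wt a + pB b + pC c = 2 := by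
    rintro a b c ⟨h1, h2⟩
    rw [hwt, hpB, hpC]
    simp only [← h1, ← h2]
    by_cases h3 : a.1 = a₁.1 <;> by_cases h4 : a.2 = a₁.2 <;> simp [h3, h4]
  -- Claim A: for `τ ≠ 0`, `f(τ)` is a restriction of `t''`
  have hA : ∀ τ : K, τ ≠ 0 → algBorderRank (fun a b c => (f a b c).eval τ) ≤ r := by
    intro τ hτ
    refine le_trans (TensorRestrictsTo.algBorderRank_le ⟨fun a' a => if a = a' then τ ^ wt a' * (τ⁻¹) ^ 2 else 0,
      fun b' b => if b = b' then τ ^ pB b' else 0, fun c' c => if c = c' then τ ^ pC c' else 0,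
      fun a' b' c' => ?_⟩) ht
    rw [Finset.sum_eq_single a' (fun a _ ha => by simp [ha]) (by simp),
      Finset.sum_eq_single b' (fun b _ hb => by simp [hb]) (by simp),
      Finset.sum_eq_single c' (fun c _ hc => by simp [hc]) (by simp)]
    simp only [if_true]
    rw [hf]
    simp only
    by_cases hd : a'.1 = b'.1 ∧ a'.2 = c'.2
    · rw [if_pos hd, eval_C]
      have e : τ ^ wt a' * τ⁻¹ ^ 2 * τ ^ pB b' * τ ^ pC c' = τ ^ (wt a' + pB b' + pC c') * τ⁻¹ ^ 2 := by
        ring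
      rw [show τ ^ wt a' * τ⁻¹ ^ 2 * τ ^ pB b' * τ ^ pC c' * t'' a' b' c' =
        (τ ^ (wt a' + pB b' + pC c') * τ⁻¹ ^ 2) * t'' a' b' c' by rw [← e], hdiag a' b' c' hd]
      field_simp
    · rw [if_neg hd, eval_mul, eval_pow, eval_X, eval_C]
      by_cases hz : t'' a' b' c' = 0
      · change τ ^ wt a' * t'' a' b' c' = _
        rw [hz]; ring
      · obtain ⟨h1, h2⟩ := hsupp a' b' c' hz hd
        change τ ^ wt a' * t'' a' b' c' = _
        rw [h1, h2]
        field_simp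
  -- Claim B: `f(0) = x(a₁) · T^{λ ∪ {a₁}}`
  have hB : (fun a b c => (f a b c).eval 0) = fun a b c => x a₁ * delSlices (insert a₁ D) T a b c := by
    funext a b c
    rw [hf]
    simp only
    by_cases hd : a.1 = b.1 ∧ a.2 = c.2
    · rw [if_pos hd, eval_C, ht'']
      simp only [delSlices_apply, Finset.mem_insert]
      by_cases ha : a = a₁
      · subst ha; simp
      · simp only [ha, false_or]
        by_cases haD : a ∈ D
        · simp only [haD, if_true, mul_zero, zero_sub, neg_eq_zero, mul_eq_zero]
          by_cases h1 : a₁ ∈ D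
          · simp [h1]
          · right; rw [if_neg h1]
            simp only [hT, matMulTensor]
            rw [if_neg]
            rintro ⟨h2, -, h3⟩
            exact ha (Prod.ext (hd.1.trans h2.symm) (hd.2.trans h3.symm))
        · simp only [haD, if_false, sub_eq_self, mul_eq_zero]
          by_cases h1 : a₁ ∈ D
          · simp [h1]
          · right; rw [if_neg h1]
            simp only [hT, matMulTensor]
            rw [if_neg]
            rintro ⟨h2, -, h3⟩
            exact ha (Prod.ext (hd.1.trans h2.symm) (hd.2.trans h3.symm))
    · rw [if_neg hd, eval_mul, eval_pow, eval_X, eval_C]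
      have hrhs : delSlices (insert a₁ D) T a b c = 0 := by
        rw [delSlices_apply]
        split_ifs
        · rfl
        · simp only [hT, matMulTensor]
          rw [if_neg]
          exact fun h => hd ⟨h.1, h.2.2⟩
      rw [hrhs, mul_zero]
      by_cases hz : t'' a b c = 0
      · rw [hz, mul_zero]
      · have hwt0 : wt a ≠ 0 := by
          intro h0
          obtain ⟨h1, h2⟩ := hsupp a b c hz hd
          rw [hwt] at h0
          simp only [Nat.add_eq_zero_iff, ite_eq_left_iff, one_ne_zero, imp_false, not_not] at h0
          rw [hpB] at h1; rw [hpC] at h2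
          simp only [ite_eq_left_iff, zero_ne_one, imp_false, not_not] at h1 h2
          exact hd ⟨h0.1.trans h1.symm, h0.2.trans h2.symm⟩
        rw [zero_pow hwt0, zero_mul]
  have key := algBorderRank_eval_zero_le f r hA
  rw [hB] at key
  -- unscale
  refine le_trans ?_ key
  have := algBorderRank_restrict₁_le (fun a b c => x a₁ * delSlices (insert a₁ D) T a b c)
    (fun a' a => if a = a' then (x a₁)⁻¹ else 0)
  refine le_trans (le_of_eq ?_) this
  congr 1
  funext a' b c
  rw [Finset.sum_eq_single a' (fun a _ ha => by simp [ha]) (by simp)]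
  simp [hx]

end Degeneration

/-! ## Part 1: the border substitution step and its iteration -/

section MainStep

variable {K : Type} [Field K] [IsAlgClosed K] {n w : ℕ}

/-- **One step of LM18 Part 1**: for a Young diagram `λ` with `⟨n,w,n⟩^λ ≠ 0` there is an addable cell
`a₁ ∉ λ` (so that `λ ∪ {a₁}` is again a Young diagram) with `R̲(⟨n,w,n⟩^{λ ∪ {a₁}}) ≤ R̲(⟨n,w,n⟩^λ) − 1`.
Proof: take an optimal approximate decomposition; drop the components of its first vectors on `λ`;
some first vector `u_{ρ₀} = ε^s ũ` is non-zero with `ũ(0) = x`, `x(a₀) ≠ 0`, `a₀ ∉ λ`; pick an addable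
`a₁ ≤ a₀` and a Borel move making the transformed `x` non-zero at `a₁`; substitute at `a₁`
(`IsApproxDecomposition.substitute`); degenerate by the torus (`algBorderRank_delSlices_insert_le`).
[cite: LandsbergMichalek2018, §3 (Part 1) with Prop. 2.3 and Lemma 2.2] -/
theorem exists_addable_algBorderRank_succ_le (D : Finset (Fin n × Fin n))
    (hD : IsLowerSet (D : Set (Fin n × Fin n)))
    (hne : delSlices D (matMulTensor K n w n) ≠ 0) :
    ∃ a₁ ∉ D, IsLowerSet ((insert a₁ D : Finset _) : Set (Fin n × Fin n)) ∧
      algBorderRank (delSlices (insert a₁ D) (matMulTensor K n w n)) + 1 ≤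
        algBorderRank (delSlices D (matMulTensor K n w n)) := by
  classical
  -- an optimal approximate decomposition with `r + 1` triads
  have h1 : 1 ≤ algBorderRank (delSlices D (matMulTensor K n w n)) := one_le_algBorderRank_of_ne_zero hne
  obtain ⟨h₀, hh₀⟩ := exists_algBorderRank_eq_approxRank (delSlices D (matMulTensor K n w n))
  obtain ⟨r, hr⟩ : ∃ r, approxRank h₀ (delSlices D (matMulTensor K n w n)) = r + 1 :=
    ⟨approxRank h₀ (delSlices D (matMulTensor K n w n)) - 1, by omega⟩
  have hex := exists_isApproxDecomposition_approxRank h₀ (delSlices D (matMulTensor K n w n))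
  rw [hr] at hex
  obtain ⟨u, v, w', hd⟩ := hex
  -- drop the components on `λ`
  have hd' := hd.proj_delSlices D
  set u' : Fin (r + 1) → Fin n × Fin n → K[X] := fun ρ a => if a ∈ D then 0 else u ρ a with hu'
  -- some `u'_{ρ₀} ≠ 0`
  obtain ⟨ρ₀, hρ₀⟩ : ∃ ρ₀, u' ρ₀ ≠ 0 := by
    by_contra hall
    push Not at hall
    apply hne
    funext a b c
    have := hd' a b c h₀ le_rfl
    rw [if_pos rfl] at this
    rw [← this]
    simp [hall]
  -- its leading coefficient `x`, supported off `λ`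
  obtain ⟨s, ut, hut, a₀, ha₀⟩ := exists_X_pow_mul_of_ne_zero (u' ρ₀) hρ₀
  set xv : Fin n × Fin n → K := fun a => (ut a).coeff 0 with hxv
  have hxD : ∀ a ∈ D, ut a = 0 := by
    intro a ha
    have h2 := hut a
    rw [hu'] at h2
    simp only [ha, if_true] at h2
    exact (mul_eq_zero.1 h2.symm).resolve_left (pow_ne_zero _ X_ne_zero)
  have ha₀D : a₀ ∉ D := fun h => ha₀ (by rw [hxD a₀ h, coeff_zero])
  -- the addable cell `a₁ ≤ a₀` and the Borel move
  obtain ⟨a₁, ha₁₀, ha₁D, hD₁⟩ := exists_addable_le D hD ha₀D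
  obtain ⟨lam, mu, hlam, hmu, hc⟩ := exists_transvection_params xv a₀ a₁ ha₀
  have hd₂ := hd'.lm_transform D hD (show a₁.1 ≤ a₀.1 from ha₁₀.1)
    (show a₁.2 ≤ a₀.2 from ha₁₀.2) hlam hmu
  set ut₂ : Fin n × Fin n → K[X] :=
    fun a' => ∑ a, C (lmA D a₁.1 a₀.1 a₁.2 a₀.2 lam mu a' a) * ut a with hut₂def
  have hut₂ : ∀ a', (∑ a, C (lmA D a₁.1 a₀.1 a₁.2 a₀.2 lam mu a' a) * u' ρ₀ a) = X ^ s * ut₂ a' := by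
    intro a'
    rw [hut₂def]
    simp only
    rw [Finset.mul_sum]
    exact Finset.sum_congr rfl fun a _ => by rw [hut a]; ring
  -- substitute at `a₁`
  have hd₃ := hd₂.substitute ρ₀ hut₂ (fun a => if a = a₁ then 1 else 0)
  set x₂ : Fin n × Fin n → K := fun a => (ut₂ a).coeff 0 with hx₂
  have hx₂a₁ : x₂ a₁ = xv (a₁.1, a₁.2) + mu * xv (a₁.1, a₀.2) + lam * xv (a₀.1, a₁.2) +
      lam * mu * xv (a₀.1, a₀.2) := by
    have key := sum_lmA_mul D a₁.1 a₀.1 a₁.2 a₀.2 lam mu (by simpa using ha₁D) xv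
    rw [Prod.mk.eta] at key
    rw [← key, hx₂]
    simp only
    rw [hut₂def]
    simp only [finsetSum_coeff, coeff_C_mul]
    rfl
  have hx₂ne : x₂ a₁ ≠ 0 := by rw [hx₂a₁]; exact hc
  have hbR : algBorderRank (fun a b c => x₂ a₁ * delSlices D (matMulTensor K n w n) a b c - x₂ a * delSlices D (matMulTensor K n w n) a₁ b c) ≤ r := by
    have h3 := approxRank_le_of_isApproxDecomposition hd₃
    have e : (fun a b c => (∑ a', (if a' = a₁ then (1 : K) else 0) * (ut₂ a').coeff 0) *
          delSlices D (matMulTensor K n w n) a b c -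
        (ut₂ a).coeff 0 * ∑ a', (if a' = a₁ then (1 : K) else 0) * delSlices D (matMulTensor K n w n) a' b c) =
        fun a b c => x₂ a₁ * delSlices D (matMulTensor K n w n) a b c - x₂ a * delSlices D (matMulTensor K n w n) a₁ b c := by
      funext a b c
      simp [hx₂, ite_mul]
    rw [e] at h3
    exact (algBorderRank_le_approxRank h₀ _).trans h3
  have hfin := algBorderRank_delSlices_insert_le D a₁ x₂ hx₂ne r hbR
  refine ⟨a₁, ha₁D, hD₁, ?_⟩
  rw [hh₀, hr]
  omega

/-- **LM18 Part 1** ("for any `k < n` there exists a Young diagram `λ` with `k` boxes such that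
`R̲(M^λ) ≤ R̲(M) − k`"), here for all `k < n²` and `w ≥ 1`: iterate the previous step from `λ = ∅`.
[cite: LandsbergMichalek2018, §3 (Part 1)] -/
theorem exists_isLowerSet_algBorderRank_add_le (hw : 1 ≤ w) :
    ∀ m : ℕ, m < n * n → ∃ D : Finset (Fin n × Fin n), IsLowerSet (D : Set (Fin n × Fin n)) ∧
      D.card = m ∧ algBorderRank (delSlices D (matMulTensor K n w n)) + m ≤
        algBorderRank (matMulTensor K n w n)
  | 0 => fun _ => ⟨∅, by simpa using isLowerSet_empty, rfl, by simp [show delSlices ∅ (matMulTensor K n w n) =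
      matMulTensor K n w n from funext fun a => funext fun b => funext fun c => by simp [delSlices_apply]]⟩
  | m + 1 => fun hm => by
      classical
      obtain ⟨D, hD, hcard, hle⟩ := exists_isLowerSet_algBorderRank_add_le hw m (by omega)
      have hne : delSlices D (matMulTensor K n w n) ≠ 0 := by
        obtain ⟨a, -, ha⟩ := Finset.exists_mem_notMem_of_card_lt_card
          (s := D) (t := (Finset.univ : Finset (Fin n × Fin n)))
          (by rw [Finset.card_univ, Fintype.card_prod, Fintype.card_fin, hcard]; omega)
        intro h0
        have := congrFun (congrFun (congrFun h0 a) (a.1, ⟨0, hw⟩)) (⟨0, hw⟩, a.2)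
        simp [delSlices_apply, ha, matMulTensor] at this
      obtain ⟨a₁, ha₁D, hD₁, hstep⟩ := exists_addable_algBorderRank_succ_le D hD hne
      exact ⟨insert a₁ D, hD₁, by rw [Finset.card_insert_of_notMem ha₁D, hcard], by omega⟩

end MainStep


end Literature.Computability.AlgebraicComplexity

end
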